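import Literature.NumberTheory.EllipticCurves.BSDSelmerPConverseHeegnerMainConjectureProofs
import HarnessLib

/-!
# The `p`-converse from the RATIONAL Heegner point main conjecture: the `Λ`-module skeleton, proved

Sibling proof file (theorems only, no named fact, D-0014/D-0026) of
`Literature.NumberTheory.EllipticCurves.BSDSelmerPConverseYanZhuProofs`, in the story of the named
fact `Literature.NumberTheory.EllipticCurves.yanZhu_analyticRank_eq_one_of_selmerCorank_eq_one`
(X. Yan, X. Zhu, *Main conjectures for non-CM elliptic curves at good ordinary primes*,
arXiv:2412.20078 = J. Algebra (2026), Cor. 1.4 = Thm. 4.15, (2) ⇒ (3) for `r = 1`), whose one leaf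
not in the tree is the `K`-level `p`-converse
"`corank_{ℤ_p} Sel_{p^∞}(E/K) = 1 ⟹ ord_{s=1} L(E/K, s) = 1`" WITHOUT ramification hypothesis
(the inline hypothesis `hL` of `yanZhu_analyticRank_eq_one_of_selmerCorank_eq_one_of_leaves`).
Its printed proof (§4.6, proof of Thm. 4.15, chunk 12 of the held text `paper:arxiv-2412.20078`)
is the single sentence

> "Similarly to [Wan], by applying descent arguments to (the rational part of) Theorem 4.12 (2)
> and using Gross-Zagier formula, we have `corank_{ℤ_p} Sel_{p^∞}(E/K) = 1` implies
> `ord_{s=1} L(E/K, s) = 1`",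

where Thm. 4.12 (2) (§4.5, chunk 11) is Perrin-Riou's Heegner point main conjecture (Conj. 4.11:
"`S_ord(E/K_∞^-)` and `𝒳_ord(E/K_∞^-)` are both `Λ_K^-`-rank one, and
`Char_{Λ_K^-}(𝒳_ord(E/K_∞^-)_tor) = Char_{Λ_K^-}(S_ord(E/K_∞^-)/Λ_K^- · κ)²`") proved RATIONALLY:

> "(2) `S_ord(E/K_∞^-)` and `𝒳_ord(E/K_∞^-)` are both `Λ_K^-`-rank one, and
> `Char_{Λ_K^-}(𝒳_ord(E/K_∞^-)_tor) ⊗ ℚ_p = Char_{Λ_K^-}(S_ord(E/K_∞^-)/Λ_K^- · κ)² ⊗ ℚ_p`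
> holds in `Λ_K ⊗ ℚ_p`. Moreover, if (Im) holds, then [the same integrally]",

`κ ∈ S_ord(E/K_∞^-)` being Perrin-Riou's `Λ`-adic Heegner class, "`Λ_K^-`-non-torsion by
Cornut-Vatsal" (§4.5), and "[Wan]" the descent of X. Wan, *Heegner point Kolyvagin system and
Iwasawa main conjecture*, Acta Math. Sin. (Engl. Ser.) 37 (2021), Thm. 3.17, whose module theory
is proved — for the INTEGRAL relation in Howard–Wan's form `char_Λ(M) ⊆ char_Λ(S/Λκ)` along
Howard's pseudo-isomorphism `𝒳 ∼ Λ ⊕ M ⊕ M` — in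
`Literature.NumberTheory.EllipticCurves.BSDSelmerPConverseHeegnerMainConjectureProofs`
(`IwasawaAlgebra.pow_smul_notMem_TSubmodule_of_charIdeal_le`; Steps 1–3 there).

## What is proved

That Wan's descent goes through verbatim with only the RATIONAL part of the relation, in
Perrin-Riou's SQUARED form and with "`𝒳` has `Λ`-rank one" as the structural input — i.e. the
module theory behind the quoted sentence — over `Λ = IwasawaAlgebra p = ℤ_[p]⟦T⟧` (`𝔭 = (T)`,
`I = (T)`, `N_Γ = N/TN = IwasawaAlgebra.coinvariants p N`). Only Step 2 of Wan's paragraph changes;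
Steps 1 and 3 are the tree theorems `finite_coinvariants_of_coinvariantsRank_le_one` /
`pow_smul_notMem_TSubmodule_of_lengthAt_eq_zero`.

* `IwasawaAlgebra.lengthAt_primeT_eq_zero_of_mem_charIdeal_sq` — the one computation: if `N` is
  finitely generated torsion and `char(N)²` contains an element `x` with `ord_T x = 0`, then
  `N_𝔭 = 0`; for with `char(N) = (g)` one gets `g² ∣ x`, so `2 ord_T g ≤ ord_T x = 0` in the DOMAIN
  `Λ` (`PowerSeries.order_mul`), and `ℓ_𝔭(N) ≤ ord_T g = 0` (`lengthAt_primeT_le_order`). No unique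
  factorisation in `Λ` and no square root of an ideal is taken: the squared rational relation is
  consumed as printed.
* Step 2, three forms. `…_of_C_mul_charIdeal_le_sq` (**rank-one form**, the literal shape of
  Thm. 4.12 (2)): `Xt` finitely generated torsion with `Xt/TXt` finite and
  `c · char(Xt) ⊆ char(N)²`, `c ∈ ℤ_p ∖ {0}` ⟹ `N_𝔭 = 0` (`x = c f`, `char(Xt) = (f)`, `T ∤ f` by
  Greenberg's Lemma 4.2, tree theorem `order_charGenerator_eq_zero_of_finite_coinvariants`);
  `…_of_C_mul_charIdeal_sq_le` (**Howard form**, `c · char(M)² ⊆ char(N)²`, for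
  `char(𝒳_tor) = char(M)²` along `𝒳 ∼ Λ ⊕ M ⊕ M`); `…_of_C_mul_charIdeal_le` (**unsquared rational
  form** `c · char(M) ⊆ char(N)`, Howard–Wan's relation `⊗ ℚ_p`, the shape of
  Castella–Grossi–Skinner's Thm. 4.13 of the source and of Burungale–Castella–Skinner, IMRN 2025,
  Thm. 1.2.2 (a)). "`⊆` in `Λ ⊗ ℚ_p = Λ[1/p]`" is written with denominators cleared, `c · I ⊆ J`
  for a nonzero constant `c ∈ ℤ_p ⊂ Λ` (`PowerSeries.C c`; one may take `c = p^k`).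
* Step 1, rank-one form: `finite_coinvariants_of_coinvariantsRank_le_one_of_prod` — if
  `ψ : X → Λ ⊕ Xt` has finite cokernel and `rank_{ℤ_p} X/TX ≤ 1` then `Xt/TXt` is finite
  (`1 + ℓ_𝔭(Xt_Γ) ≤ ℓ_𝔭(X_Γ) ≤ 1`).
* **The `p`-converse lemmas from the rational main conjecture**:
  `pow_smul_notMem_TSubmodule_of_C_mul_charIdeal_le_sq` (rank-one form: `S` finitely generated
  torsion-free, `κ ∈ S` nonzero with `S/Λκ` torsion; `ψ : X → Λ ⊕ Xt` with finite cokernel, `Xt`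
  torsion; `c · char(Xt) ⊆ char(S/Λκ)²`; `rank_{ℤ_p} X/TX ≤ 1` ⟹ `p^m κ ∉ TS` for all `m`),
  `…_of_C_mul_charIdeal_sq_le` and `…_of_C_mul_charIdeal_le` (Howard forms); the integral tree
  lemma is the case `c = 1` of the last (`span_C_one_mul`).
* **Howard's shape** (the literal output of the tree fact `Howard2004_thmB`, Howard 2004 Thm. B as
  vendored in `HeegnerModuleIndex`: `S` finitely generated, torsion-free, `Module.finrank Λ S = 1`;
  `X` finitely generated with `Module.finrank Λ X = 1` and the torsion SUBMODULE
  `Submodule.torsion Λ X` in the role of `𝒳_tor`): `isTorsion_quotient_span_singleton_of_finrank_eq_one`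
  (`S/Λκ` is torsion, rank–nullity), `finite_coinvariants_torsion_of_finrank_eq_one` (Step 1 from
  `rank X = 1`: `ℓ_𝔭((X_tors)_Γ) + ℓ_𝔭((X/X_tors)_Γ) = rank_{ℤ_p} X/TX ≤ 1` and
  `ℓ_𝔭((X/X_tors)_Γ) ≥ 1`, the latter because a nonzero finitely generated torsion-free `Λ`-module
  has infinite `Γ`-coinvariants, `not_finite_coinvariants_of_isTorsionFree`, by Cayley–Hamilton),
  and the `p`-converse lemma `pow_smul_notMem_TSubmodule_of_finrank_eq_one` with its index form
  `lengthAt_quotient_span_singleton_eq_zero_of_finrank_eq_one` ("`ord_J char(S/Λκ) = 0`", i.e.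
  Howard's Heegner-module index vanishes) and specialisation.
* The conclusion in `S_Γ = S/IS` and after a specialisation with `p`-power-torsion kernel, keyed
  on `(S/Λκ)_𝔭 = 0` so that every form above feeds them
  (`pow_smul_mkQ_ne_zero_of_lengthAt_eq_zero`, `C_smul_mkQ_ne_zero_of_lengthAt_eq_zero`,
  `pow_smul_specialization_ne_zero_of_lengthAt_eq_zero`), and spelled out for the rank-one form
  (`pow_smul_specialization_ne_zero_of_C_mul_charIdeal_le_sq`: "`κ₁`, the Kummer image of the
  Heegner point `y_K`, is non-torsion"; Gross–Zagier–Kolyvagin, tree fact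
  `analyticRankEK_eq_one_iff_heegner_nonTorsion`, then gives `ord_{s=1} L(E/K, s) = 1`).

## How this serves the Yan–Zhu fact

With the arithmetic inputs of §4.5 for `(E, K, p)` — `S = S_ord(E/K_∞^-) ∋ κ` (rank one,
`κ ≠ 0`), `X = 𝒳_ord(E/K_∞^-)` of rank one (a `Λ`-linear `X → Λ ⊕ Xt` with finite cokernel and
`char(Xt) = char(X_tor)`, e.g. from the structure theorem), the rational equality of Thm. 4.12 (2),
the anticyclotomic control theorem and the specialisation `S_Γ → H¹_f(K, T_pE) ⊗ ℚ` onto the Kummer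
image of `y_K` — none of which is a tree object yet — the theorems below yield "`y_K`
non-torsion", and Gross–Zagier–Kolyvagin turns this into `analyticRankEK W K = 1`. Nothing is
asserted here: the file adds no `def … : Prop`.

## References

* [YanZhu2024MainConjNonCM] X. Yan, X. Zhu, arXiv:2412.20078 = J. Algebra (2026),
  doi:10.1016/j.jalgebra.2026.01.016: Conj. 4.11, Thm. 4.12 (2), Thm. 4.13 (§4.5, chunk 11 of the
  held text), Thm. 4.15 and its proof (§4.6, chunk 12).
* [Wan2021HeegnerPointKolyvaginSystem] X. Wan, Acta Math. Sin. (Engl. Ser.) 37 (2021), 104–120 =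
  arXiv:1408.4043: Thm. 3.17 and its proof (p. 10 of the held text), Thms. 1.1–1.2.
* B. Perrin-Riou, *Fonctions `L` `p`-adiques, théorie d'Iwasawa et points de Heegner*, Bull. Soc.
  Math. France 115 (1987), 399–456 (the squared formulation, Conj. B).
* B. Howard, *The Heegner point Kolyvagin system*, Compos. Math. 140 (2004), 1439–1472, Thm. B.
* [BurungaleCastellaSkinner2025] A. Burungale, F. Castella, C. Skinner, IMRN 2025 =
  arXiv:2405.00270, Thm. 1.2.2 (a) and the remark following it.
* R. Greenberg, *Iwasawa theory for elliptic curves*, LNM 1716 (1999), §4 Lemma 4.2.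
-/

noncomputable section

universe u v w

namespace Literature.NumberTheory.EllipticCurves.IwasawaAlgebra

variable (p : ℕ) [Fact p.Prime]

/-! ### `T`-orders: constants, and square divisors of an element of order zero -/

/-- A nonzero constant `c ∈ ℤ_p ⊂ Λ = ℤ_p⟦T⟧` has `ord_T c = 0`. [folklore] -/
theorem order_C_eq_zero {c : ℤ_[p]} (hc : c ≠ 0) :
    PowerSeries.order (PowerSeries.C c : IwasawaAlgebra p) = 0 := by
  by_contra h
  rw [← Ne, PowerSeries.order_ne_zero_iff_constCoeff_eq_zero, PowerSeries.constantCoeff_C] at h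
  exact hc h

/-- In particular `ord_T (p^k) = 0` in `Λ` (`p ≠ 0` in `ℤ_p`). [folklore] -/
theorem order_natCast_pow_eq_zero (k : ℕ) :
    PowerSeries.order ((p : IwasawaAlgebra p) ^ k) = 0 := by
  have h : ((p : IwasawaAlgebra p) ^ k) = PowerSeries.C ((p : ℤ_[p]) ^ k) := by
    rw [map_pow, map_natCast]
  rw [h]
  exact order_C_eq_zero p (pow_ne_zero k (NeZero.ne (p : ℤ_[p])))

/-- In the domain `Λ = ℤ_p⟦T⟧`: if `g² ∣ x` and `ord_T x = 0` then `ord_T g = 0`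
(`2 ord_T g ≤ ord_T q + 2 ord_T g = ord_T x`, `PowerSeries.order_mul`). [folklore] -/
theorem order_eq_zero_of_mem_span_sq {g x : IwasawaAlgebra p} (hx : x ∈ Ideal.span {g ^ 2})
    (h0 : PowerSeries.order x = 0) : PowerSeries.order g = 0 := by
  obtain ⟨q, hq⟩ := Ideal.mem_span_singleton'.mp hx
  have h2 : PowerSeries.order (g ^ 2) ≤ 0 := by
    calc PowerSeries.order (g ^ 2)
        ≤ PowerSeries.order q + PowerSeries.order (g ^ 2) := le_add_self
      _ = PowerSeries.order (q * g ^ 2) := (PowerSeries.order_mul q (g ^ 2)).symm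
      _ = 0 := by rw [hq, h0]
  have h1 : PowerSeries.order g ≤ PowerSeries.order (g ^ 2) := by
    rw [pow_two, PowerSeries.order_mul]
    exact le_add_self
  exact nonpos_iff_eq_zero.mp (h1.trans h2)

/-! ### Step 2 of Wan's descent, run rationally -/

/-- **The computation behind the rational Step 2.** If `N` is a finitely generated torsion
`Λ`-module and `char(N)²` contains an element `x` with `ord_T x = 0`, then `N_𝔭 = 0` at
`𝔭 = (T)`: with `char(N) = (g)` (`charIdeal_isPrincipal_holds`) one has `g² ∣ x`, so
`ord_T g = 0` (`order_eq_zero_of_mem_span_sq`) and `ℓ_𝔭(N) ≤ ord_T g = 0`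
(`lengthAt_primeT_le_order`). [folklore] -/
theorem lengthAt_primeT_eq_zero_of_mem_charIdeal_sq {N : Type v}
    [AddCommGroup N] [Module (IwasawaAlgebra p) N] [Module.Finite (IwasawaAlgebra p) N]
    (hN : Module.IsTorsion (IwasawaAlgebra p) N) {x : IwasawaAlgebra p}
    (hx : x ∈ Module.charIdeal (IwasawaAlgebra p) N ^ 2) (h0 : PowerSeries.order x = 0) :
    Module.lengthAt (IwasawaAlgebra p) N (primeT p) = 0 := by
  obtain ⟨g, hg⟩ := (charIdeal_isPrincipal_holds p N).principal
  have hg' : Module.charIdeal (IwasawaAlgebra p) N = Ideal.span {g} := hg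
  rw [hg', Ideal.span_singleton_pow] at hx
  have h := lengthAt_primeT_le_order N hN g (hg' ▸ Ideal.mem_span_singleton_self g)
  rw [order_eq_zero_of_mem_span_sq p hx h0] at h
  exact nonpos_iff_eq_zero.mp h

/-- **Step 2, rank-one form — the literal shape of Yan–Zhu's Thm. 4.12 (2)** ("descent arguments
[applied] to (the rational part of) Theorem 4.12 (2)", proof of Thm. 4.15). Let `Xt`, `N` be
finitely generated torsion `Λ`-modules (`Xt` in the role of `𝒳_ord(E/K_∞^-)_tor`, `N` in the role
of `S_ord(E/K_∞^-)/Λκ`) with `Xt/TXt` finite, and assume `c · char(Xt) ⊆ char(N)²` for a nonzero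
constant `c ∈ ℤ_p` — the containment `Char(𝒳_tor) ⊗ ℚ_p ⊆ Char(S/Λκ)² ⊗ ℚ_p` in `Λ ⊗ ℚ_p`,
denominators cleared. Then `N_𝔭 = 0`: `char(Xt) = (f)` with `ord_T f = 0` (Greenberg's Lemma 4.2,
`order_charGenerator_eq_zero_of_finite_coinvariants`), and `x = c f ∈ char(N)²` has `ord_T x = 0`.
[cite: YanZhu2024MainConjNonCM, Thm. 4.12 (2) (§4.5) and proof of Thm. 4.15 (§4.6)]
[cite: Wan2021HeegnerPointKolyvaginSystem, proof of Thm. 3.17 (p. 10)] -/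
theorem lengthAt_primeT_eq_zero_of_C_mul_charIdeal_le_sq {Xt : Type u} {N : Type v}
    [AddCommGroup Xt] [Module (IwasawaAlgebra p) Xt] [Module.Finite (IwasawaAlgebra p) Xt]
    [AddCommGroup N] [Module (IwasawaAlgebra p) N] [Module.Finite (IwasawaAlgebra p) N]
    (hXt : Module.IsTorsion (IwasawaAlgebra p) Xt) (hN : Module.IsTorsion (IwasawaAlgebra p) N)
    (hfin : Finite (coinvariants p Xt)) {c : ℤ_[p]} (hc : c ≠ 0)
    (hle : Ideal.span {(PowerSeries.C c : IwasawaAlgebra p)} *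
        Module.charIdeal (IwasawaAlgebra p) Xt ≤ Module.charIdeal (IwasawaAlgebra p) N ^ 2) :
    Module.lengthAt (IwasawaAlgebra p) N (primeT p) = 0 := by
  obtain ⟨f, hf⟩ := (charIdeal_isPrincipal_holds p Xt).principal
  have hf' : Module.charIdeal (IwasawaAlgebra p) Xt = Ideal.span {f} := hf
  have hordf : f.order = 0 :=
    order_charGenerator_eq_zero_of_finite_coinvariants p Xt hXt f hf' hfin
  refine lengthAt_primeT_eq_zero_of_mem_charIdeal_sq p hN (x := PowerSeries.C c * f)
    (hle (Ideal.mul_mem_mul (Ideal.mem_span_singleton_self _)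
      (hf' ▸ Ideal.mem_span_singleton_self f))) ?_
  rw [PowerSeries.order_mul, order_C_eq_zero p hc, hordf, zero_add]

/-- **Step 2, Howard form, squared** — for Howard's pseudo-isomorphism `𝒳 ∼ Λ ⊕ M ⊕ M`, under
which `char(𝒳_tor) = char(M)²`: `M`, `N` finitely generated torsion with `M/TM` finite and
`c · char(M)² ⊆ char(N)²`, `c ∈ ℤ_p ∖ {0}` ⟹ `N_𝔭 = 0` (`x = c f²`, `char(M) = (f)`,
`ord_T f = 0`). [cite: YanZhu2024MainConjNonCM, Thm. 4.12 (2) and proof of Thm. 4.15]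
[cite: Wan2021HeegnerPointKolyvaginSystem, Thm. 1.1 and proof of Thm. 3.17 (p. 10)] -/
theorem lengthAt_primeT_eq_zero_of_C_mul_charIdeal_sq_le {M : Type u} {N : Type v}
    [AddCommGroup M] [Module (IwasawaAlgebra p) M] [Module.Finite (IwasawaAlgebra p) M]
    [AddCommGroup N] [Module (IwasawaAlgebra p) N] [Module.Finite (IwasawaAlgebra p) N]
    (hM : Module.IsTorsion (IwasawaAlgebra p) M) (hN : Module.IsTorsion (IwasawaAlgebra p) N)
    (hfin : Finite (coinvariants p M)) {c : ℤ_[p]} (hc : c ≠ 0)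
    (hle : Ideal.span {(PowerSeries.C c : IwasawaAlgebra p)} *
        Module.charIdeal (IwasawaAlgebra p) M ^ 2 ≤ Module.charIdeal (IwasawaAlgebra p) N ^ 2) :
    Module.lengthAt (IwasawaAlgebra p) N (primeT p) = 0 := by
  obtain ⟨f, hf⟩ := (charIdeal_isPrincipal_holds p M).principal
  have hf' : Module.charIdeal (IwasawaAlgebra p) M = Ideal.span {f} := hf
  have hordf : f.order = 0 := order_charGenerator_eq_zero_of_finite_coinvariants p M hM f hf' hfin
  have hmem : PowerSeries.C c * f ^ 2 ∈ Module.charIdeal (IwasawaAlgebra p) N ^ 2 := by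
    refine hle (Ideal.mul_mem_mul (Ideal.mem_span_singleton_self _) ?_)
    rw [hf', Ideal.span_singleton_pow]
    exact Ideal.mem_span_singleton_self _
  refine lengthAt_primeT_eq_zero_of_mem_charIdeal_sq p hN hmem ?_
  rw [PowerSeries.order_mul, PowerSeries.order_pow, order_C_eq_zero p hc, hordf, smul_zero, zero_add]

/-- **Step 2, Howard form, unsquared rational** (`c · char(M) ⊆ char(N)`, `c ∈ ℤ_p ∖ {0}`:
Howard–Wan's relation `⊗ ℚ_p`, the shape of Castella–Grossi–Skinner (Thm. 4.13 of the source) and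
of Burungale–Castella–Skinner, IMRN 2025, Thm. 1.2.2 (a)): `ℓ_𝔭(N) ≤ ord_T (c f) = 0` directly.
[cite: BurungaleCastellaSkinner2025, Thm. 1.2.2 (a)]
[cite: YanZhu2024MainConjNonCM, Thm. 4.13 (§4.5)]
[cite: Wan2021HeegnerPointKolyvaginSystem, proof of Thm. 3.17 (p. 10)] -/
theorem lengthAt_primeT_eq_zero_of_C_mul_charIdeal_le {M : Type u} {N : Type v}
    [AddCommGroup M] [Module (IwasawaAlgebra p) M] [Module.Finite (IwasawaAlgebra p) M]
    [AddCommGroup N] [Module (IwasawaAlgebra p) N] [Module.Finite (IwasawaAlgebra p) N]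
    (hM : Module.IsTorsion (IwasawaAlgebra p) M) (hN : Module.IsTorsion (IwasawaAlgebra p) N)
    (hfin : Finite (coinvariants p M)) {c : ℤ_[p]} (hc : c ≠ 0)
    (hle : Ideal.span {(PowerSeries.C c : IwasawaAlgebra p)} *
        Module.charIdeal (IwasawaAlgebra p) M ≤ Module.charIdeal (IwasawaAlgebra p) N) :
    Module.lengthAt (IwasawaAlgebra p) N (primeT p) = 0 := by
  obtain ⟨f, hf⟩ := (charIdeal_isPrincipal_holds p M).principal
  have hf' : Module.charIdeal (IwasawaAlgebra p) M = Ideal.span {f} := hf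
  have hordf : f.order = 0 := order_charGenerator_eq_zero_of_finite_coinvariants p M hM f hf' hfin
  have hmem : PowerSeries.C c * f ∈ Module.charIdeal (IwasawaAlgebra p) N :=
    hle (Ideal.mul_mem_mul (Ideal.mem_span_singleton_self _)
      (hf' ▸ Ideal.mem_span_singleton_self f))
  have h := lengthAt_primeT_le_order N hN _ hmem
  rw [PowerSeries.order_mul, order_C_eq_zero p hc, hordf, zero_add] at h
  exact nonpos_iff_eq_zero.mp h

/-! ### Step 1, rank-one form -/

/-- **Step 1, rank-one form ("`𝒳_ord(E/K_∞^-)` is `Λ_K^-`-rank one", Thm. 4.12 (2)).** If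
`ψ : X → Λ ⊕ Xt` is `Λ`-linear with finite cokernel (`X` finitely generated of rank one with
torsion part pseudo-isomorphic to `Xt`) and `rank_{ℤ_p} X/TX ≤ 1`, then `Xt/TXt` is finite:
`1 + ℓ_𝔭(Xt_Γ) = ℓ_𝔭((Λ ⊕ Xt)_Γ) ≤ ℓ_𝔭(X_Γ) = rank_{ℤ_p} X/TX ≤ 1`.
[cite: YanZhu2024MainConjNonCM, Thm. 4.12 (2)]
[cite: Wan2021HeegnerPointKolyvaginSystem, proof of Thm. 3.17 (p. 10)] -/
theorem finite_coinvariants_of_coinvariantsRank_le_one_of_prod {X : Type v} {Xt : Type u}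
    [AddCommGroup X] [Module (IwasawaAlgebra p) X] [Module.Finite (IwasawaAlgebra p) X]
    [AddCommGroup Xt] [Module (IwasawaAlgebra p) Xt] [Module.Finite (IwasawaAlgebra p) Xt]
    (ψ : X →ₗ[IwasawaAlgebra p] (IwasawaAlgebra p × Xt))
    (hψ : Finite ((IwasawaAlgebra p × Xt) ⧸ LinearMap.range ψ))
    (hX : coinvariantsRank p X ≤ 1) : Finite (coinvariants p Xt) := by
  set l := Module.lengthAt (IwasawaAlgebra p) (coinvariants p Xt) (primeT p) with hl
  have hne : l ≠ ⊤ :=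
    Module.lengthAt_ne_top_of_isTorsionBy (s := (PowerSeries.X : IwasawaAlgebra p))
      PowerSeries.X_ne_zero (fun q ↦ X_smul_coinvariants p Xt q) (primeT p) (height_primeT p).le
  have h1 : 1 + l ≤ 1 := by
    have hL := lengthAt_coinvariants_le_of_finite_coker p ψ hψ
    rw [lengthAt_coinvariants_prod p (IwasawaAlgebra p) Xt, lengthAt_coinvariants_self p,
      lengthAt_coinvariants_eq_coinvariantsRank p X] at hL
    calc 1 + l ≤ (coinvariantsRank p X : ℕ∞) := hL
      _ ≤ 1 := by exact_mod_cast hX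
  have h0 : l = 0 := by
    lift l to ℕ using hne with n hn
    have h1' : 1 + n ≤ 1 := by exact_mod_cast h1
    have : n = 0 := by omega
    simp [this]
  exact (finite_iff_lengthAt_eq_zero_of_X_smul_eq_zero p (coinvariants p Xt)
    (fun q ↦ X_smul_coinvariants p Xt q)).mpr h0

/-! ### The `p`-converse lemmas from the rational Heegner point main conjecture -/

/-- **The `p`-converse lemma from the RATIONAL Heegner point main conjecture, rank-one form
(Yan–Zhu, proof of Thm. 4.15, (2) ⇒ (3): "Similarly to [Wan], by applying descent arguments to
(the rational part of) Theorem 4.12 (2) […] `corank_{ℤ_p} Sel_{p^∞}(E/K) = 1` implies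
`ord_{s=1} L(E/K, s) = 1`"; the module-theoretic skeleton of Wan 2021, Thm. 3.17 with its Step 2
run rationally and "rank one" as structural input).** Over `Λ = ℤ_[p]⟦T⟧` let
* `S` be finitely generated and torsion-free, `κ ∈ S` nonzero with `S/Λκ` torsion —
  "`S_ord(E/K_∞^-)` is `Λ_K^-`-rank one" containing Perrin-Riou's `Λ`-adic Heegner class `κ`,
  "`Λ_K^-`-non-torsion by Cornut-Vatsal" (§4.5);
* `ψ : X → Λ ⊕ Xt` be `Λ`-linear with finite cokernel, `X` finitely generated, `Xt` finitely
  generated torsion — "`𝒳_ord(E/K_∞^-)` is `Λ_K^-`-rank one", `Xt` standing for `𝒳_ord(E/K_∞^-)_tor`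
  up to pseudo-isomorphism (same characteristic ideal);
* `c · char(Xt) ⊆ char(S/Λκ)²` for a nonzero constant `c ∈ ℤ_p` — the containment
  "`Char(𝒳_ord(E/K_∞^-)_tor) ⊗ ℚ_p ⊆ Char(S_ord(E/K_∞^-)/Λ_K^- · κ)² ⊗ ℚ_p`", the half of the
  rational equality of Thm. 4.12 (2) that is used;
* `rank_{ℤ_p} X/TX ≤ 1` — the anticyclotomic control theorem "`𝒳/I𝒳 ↠ Sel_{p^∞}(E/K)^∨` has finite
  kernel" together with `corank_{ℤ_p} Sel_{p^∞}(E/K) = 1`.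
Then `p^m κ ∉ TS` for every `m`: the image of `κ` in `S_Γ = S/IS` is not `ℤ_p`-torsion.
[cite: YanZhu2024MainConjNonCM, Thm. 4.15 (proof, §4.6) with Thm. 4.12 (2) (§4.5)]
[cite: Wan2021HeegnerPointKolyvaginSystem, Thm. 3.17 (proof, p. 10)] -/
theorem pow_smul_notMem_TSubmodule_of_C_mul_charIdeal_le_sq {S : Type u} {X : Type v}
    {Xt : Type w}
    [AddCommGroup S] [Module (IwasawaAlgebra p) S] [Module.Finite (IwasawaAlgebra p) S]
    [NoZeroSMulDivisors (IwasawaAlgebra p) S]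
    [AddCommGroup X] [Module (IwasawaAlgebra p) X] [Module.Finite (IwasawaAlgebra p) X]
    [AddCommGroup Xt] [Module (IwasawaAlgebra p) Xt] [Module.Finite (IwasawaAlgebra p) Xt]
    {κ : S} (hκ : κ ≠ 0)
    (hS : Module.IsTorsion (IwasawaAlgebra p) (S ⧸ Submodule.span (IwasawaAlgebra p) {κ}))
    (ψ : X →ₗ[IwasawaAlgebra p] (IwasawaAlgebra p × Xt))
    (hψ : Finite ((IwasawaAlgebra p × Xt) ⧸ LinearMap.range ψ))
    (hXt : Module.IsTorsion (IwasawaAlgebra p) Xt)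
    {c : ℤ_[p]} (hc : c ≠ 0)
    (hMC : Ideal.span {(PowerSeries.C c : IwasawaAlgebra p)} *
        Module.charIdeal (IwasawaAlgebra p) Xt ≤
      Module.charIdeal (IwasawaAlgebra p) (S ⧸ Submodule.span (IwasawaAlgebra p) {κ}) ^ 2)
    (hX : coinvariantsRank p X ≤ 1) (m : ℕ) :
    ((p : IwasawaAlgebra p) ^ m) • κ ∉ TSubmodule p S :=
  pow_smul_notMem_TSubmodule_of_lengthAt_eq_zero p hκ
    (lengthAt_primeT_eq_zero_of_C_mul_charIdeal_le_sq p hXt hS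
      (finite_coinvariants_of_coinvariantsRank_le_one_of_prod p ψ hψ hX) hc hMC) m

/-- **The `p`-converse lemma from the rational main conjecture, Howard form, squared**: data as in
the integral tree lemma `pow_smul_notMem_TSubmodule_of_charIdeal_le` (`φ : X → Λ ⊕ M ⊕ M` with
finite cokernel, Howard's Thm. B, under which `char(𝒳_tor) = char(M)²`), with the relation
weakened to `c · char(M)² ⊆ char(S/Λκ)²`, `c ∈ ℤ_p ∖ {0}` (Thm. 4.12 (2), rational). Conclusion:
`p^m κ ∉ TS` for every `m`. [cite: YanZhu2024MainConjNonCM, Thm. 4.15 (proof, §4.6) with Thm. 4.12 (2)]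
[cite: Wan2021HeegnerPointKolyvaginSystem, Thm. 3.17 (proof, p. 10), Thm. 1.1, Thm. 1.2] -/
theorem pow_smul_notMem_TSubmodule_of_C_mul_charIdeal_sq_le {S : Type u} {X : Type v} {M : Type w}
    [AddCommGroup S] [Module (IwasawaAlgebra p) S] [Module.Finite (IwasawaAlgebra p) S]
    [NoZeroSMulDivisors (IwasawaAlgebra p) S]
    [AddCommGroup X] [Module (IwasawaAlgebra p) X] [Module.Finite (IwasawaAlgebra p) X]
    [AddCommGroup M] [Module (IwasawaAlgebra p) M] [Module.Finite (IwasawaAlgebra p) M]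
    {κ : S} (hκ : κ ≠ 0)
    (hS : Module.IsTorsion (IwasawaAlgebra p) (S ⧸ Submodule.span (IwasawaAlgebra p) {κ}))
    (hM : Module.IsTorsion (IwasawaAlgebra p) M)
    (φ : X →ₗ[IwasawaAlgebra p] (IwasawaAlgebra p × M × M))
    (hφ : Finite ((IwasawaAlgebra p × M × M) ⧸ LinearMap.range φ))
    {c : ℤ_[p]} (hc : c ≠ 0)
    (hMC : Ideal.span {(PowerSeries.C c : IwasawaAlgebra p)} *
        Module.charIdeal (IwasawaAlgebra p) M ^ 2 ≤
      Module.charIdeal (IwasawaAlgebra p) (S ⧸ Submodule.span (IwasawaAlgebra p) {κ}) ^ 2)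
    (hX : coinvariantsRank p X ≤ 1) (m : ℕ) :
    ((p : IwasawaAlgebra p) ^ m) • κ ∉ TSubmodule p S :=
  pow_smul_notMem_TSubmodule_of_lengthAt_eq_zero p hκ
    (lengthAt_primeT_eq_zero_of_C_mul_charIdeal_sq_le p hM hS
      (finite_coinvariants_of_coinvariantsRank_le_one p φ hφ hX) hc hMC) m

/-- **The `p`-converse lemma from the rational main conjecture, Howard form, unsquared**
(`c · char(M) ⊆ char(S/Λκ)`: Howard–Wan's relation `⊗ ℚ_p`; Burungale–Castella–Skinner, IMRN 2025,
Thm. 1.2.2 (a)). [cite: BurungaleCastellaSkinner2025, Thm. 1.2.2 (a) and the remark following it]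
[cite: Wan2021HeegnerPointKolyvaginSystem, Thm. 3.17 (proof, p. 10)] -/
theorem pow_smul_notMem_TSubmodule_of_C_mul_charIdeal_le {S : Type u} {X : Type v} {M : Type w}
    [AddCommGroup S] [Module (IwasawaAlgebra p) S] [Module.Finite (IwasawaAlgebra p) S]
    [NoZeroSMulDivisors (IwasawaAlgebra p) S]
    [AddCommGroup X] [Module (IwasawaAlgebra p) X] [Module.Finite (IwasawaAlgebra p) X]
    [AddCommGroup M] [Module (IwasawaAlgebra p) M] [Module.Finite (IwasawaAlgebra p) M]
    {κ : S} (hκ : κ ≠ 0)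
    (hS : Module.IsTorsion (IwasawaAlgebra p) (S ⧸ Submodule.span (IwasawaAlgebra p) {κ}))
    (hM : Module.IsTorsion (IwasawaAlgebra p) M)
    (φ : X →ₗ[IwasawaAlgebra p] (IwasawaAlgebra p × M × M))
    (hφ : Finite ((IwasawaAlgebra p × M × M) ⧸ LinearMap.range φ))
    {c : ℤ_[p]} (hc : c ≠ 0)
    (hMC : Ideal.span {(PowerSeries.C c : IwasawaAlgebra p)} *
        Module.charIdeal (IwasawaAlgebra p) M ≤
      Module.charIdeal (IwasawaAlgebra p) (S ⧸ Submodule.span (IwasawaAlgebra p) {κ}))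
    (hX : coinvariantsRank p X ≤ 1) (m : ℕ) :
    ((p : IwasawaAlgebra p) ^ m) • κ ∉ TSubmodule p S :=
  pow_smul_notMem_TSubmodule_of_lengthAt_eq_zero p hκ
    (lengthAt_primeT_eq_zero_of_C_mul_charIdeal_le p hM hS
      (finite_coinvariants_of_coinvariantsRank_le_one p φ hφ hX) hc hMC) m

/-- The integral hypothesis `char(M) ⊆ char(S/Λκ)` of the tree lemma
`pow_smul_notMem_TSubmodule_of_charIdeal_le` is the case `c = 1` of the unsquared rational one
(`(C 1) · I = ⊤ · I = I`); recorded as the hypothesis-level identity, the tree lemma itself being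
importable. [folklore] -/
theorem span_C_one_mul (I : Ideal (IwasawaAlgebra p)) :
    Ideal.span {(PowerSeries.C (1 : ℤ_[p]) : IwasawaAlgebra p)} * I = I := by
  rw [map_one, Ideal.span_singleton_one, Ideal.top_mul]

/-! ### The conclusion in `S_Γ = S/IS` and after specialisation, keyed on `(S/Λκ)_𝔭 = 0` -/

/-- **`p^m • (κ mod TS) ≠ 0` for every `m`** whenever `S` is torsion-free, `κ ≠ 0` and
`(S/Λκ)_𝔭 = 0` (the common output of every form of Step 2): the class of `κ` in the
`Γ`-coinvariants has infinite `p`-power order.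
[cite: Wan2021HeegnerPointKolyvaginSystem, Thm. 3.17 (proof, p. 10)] -/
theorem pow_smul_mkQ_ne_zero_of_lengthAt_eq_zero {S : Type u} [AddCommGroup S]
    [Module (IwasawaAlgebra p) S] [NoZeroSMulDivisors (IwasawaAlgebra p) S]
    {κ : S} (hκ : κ ≠ 0)
    (hS0 : Module.lengthAt (IwasawaAlgebra p) (S ⧸ Submodule.span (IwasawaAlgebra p) {κ})
      (primeT p) = 0) (m : ℕ) :
    p ^ m • (Submodule.Quotient.mk κ : coinvariants p S) ≠ 0 := by
  intro h0
  apply pow_smul_notMem_TSubmodule_of_lengthAt_eq_zero p hκ hS0 m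
  rw [← Nat.cast_smul_eq_nsmul (IwasawaAlgebra p), ← Submodule.Quotient.mk_smul,
    Submodule.Quotient.mk_eq_zero, Nat.cast_pow] at h0
  exact h0

/-- `ℤ_p`-form: **`c' • (κ mod TS) ≠ 0` for every nonzero `c' ∈ ℤ_p`** (acting through
`PowerSeries.C : ℤ_p → Λ`), whenever `(S/Λκ)_𝔭 = 0`; write `c' = u · p^v` (`PadicInt.unitCoeff`).
So the class of `κ` in `S/IS` is not `ℤ_p`-torsion.
[cite: Wan2021HeegnerPointKolyvaginSystem, Thm. 3.17 (proof, p. 10)] -/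
theorem C_smul_mkQ_ne_zero_of_lengthAt_eq_zero {S : Type u} [AddCommGroup S]
    [Module (IwasawaAlgebra p) S] [NoZeroSMulDivisors (IwasawaAlgebra p) S]
    {κ : S} (hκ : κ ≠ 0)
    (hS0 : Module.lengthAt (IwasawaAlgebra p) (S ⧸ Submodule.span (IwasawaAlgebra p) {κ})
      (primeT p) = 0) {c' : ℤ_[p]} (hc' : c' ≠ 0) :
    (PowerSeries.C c' : IwasawaAlgebra p) • (Submodule.Quotient.mk κ : coinvariants p S) ≠ 0 := by
  intro h0
  apply pow_smul_mkQ_ne_zero_of_lengthAt_eq_zero p hκ hS0 c'.valuation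
  have hu : IsUnit (PowerSeries.C ((PadicInt.unitCoeff hc' : ℤ_[p])) : IwasawaAlgebra p) :=
    (Units.isUnit _).map (PowerSeries.C : ℤ_[p] →+* IwasawaAlgebra p)
  rw [PadicInt.unitCoeff_spec hc', map_mul, map_pow, map_natCast, mul_smul, hu.smul_eq_zero,
    ← Nat.cast_pow, Nat.cast_smul_eq_nsmul] at h0
  exact h0

/-- **Specialisation**, whenever `(S/Λκ)_𝔭 = 0`: if `sp : S/IS → H` is additive with
`p`-power-torsion kernel (an injection after `⊗ ℚ_p`), then `p^m • sp (κ mod IS) ≠ 0` for every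
`m`. [cite: Wan2021HeegnerPointKolyvaginSystem, Thm. 3.17 (proof, p. 10)] -/
theorem pow_smul_specialization_ne_zero_of_lengthAt_eq_zero {S : Type u} {H : Type*}
    [AddCommGroup S] [Module (IwasawaAlgebra p) S] [NoZeroSMulDivisors (IwasawaAlgebra p) S]
    [AddCommGroup H] {κ : S} (hκ : κ ≠ 0)
    (hS0 : Module.lengthAt (IwasawaAlgebra p) (S ⧸ Submodule.span (IwasawaAlgebra p) {κ})
      (primeT p) = 0)
    (sp : coinvariants p S →+ H) (hsp : ∀ x, sp x = 0 → ∃ n : ℕ, p ^ n • x = 0) (m : ℕ) :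
    p ^ m • sp (Submodule.Quotient.mk κ) ≠ 0 := by
  intro h0
  rw [← map_nsmul] at h0
  obtain ⟨n, hn⟩ := hsp _ h0
  rw [← mul_nsmul', ← pow_add] at hn
  exact pow_smul_mkQ_ne_zero_of_lengthAt_eq_zero p hκ hS0 (n + m) hn

/-- **Specialisation, rank-one form ("and using Gross-Zagier formula").** In the situation of
`pow_smul_notMem_TSubmodule_of_C_mul_charIdeal_le_sq`, if moreover `sp : S/IS → H` is additive with
`p`-power-torsion kernel (an injection after `⊗ ℚ_p`: the specialisation of `S_ord(E/K_∞^-)` to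
`H¹_f(K, T_pE)`, carrying `κ` to the Kummer image `κ₁` of the Heegner point `y_K`), then
`p^m • κ₁ ≠ 0` for every `m`, i.e. `y_K` is non-torsion; Gross–Zagier–Kolyvagin (tree fact
`analyticRankEK_eq_one_iff_heegner_nonTorsion`) then gives `ord_{s=1} L(E/K, s) = 1`, the
conclusion of the quoted sentence. [cite: YanZhu2024MainConjNonCM, Thm. 4.15 (proof, §4.6)]
[cite: Wan2021HeegnerPointKolyvaginSystem, Thm. 3.17 (proof, p. 10)] -/
theorem pow_smul_specialization_ne_zero_of_C_mul_charIdeal_le_sq {S : Type u} {X : Type v}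
    {Xt : Type w} {H : Type*}
    [AddCommGroup S] [Module (IwasawaAlgebra p) S] [Module.Finite (IwasawaAlgebra p) S]
    [NoZeroSMulDivisors (IwasawaAlgebra p) S]
    [AddCommGroup X] [Module (IwasawaAlgebra p) X] [Module.Finite (IwasawaAlgebra p) X]
    [AddCommGroup Xt] [Module (IwasawaAlgebra p) Xt] [Module.Finite (IwasawaAlgebra p) Xt]
    [AddCommGroup H]
    {κ : S} (hκ : κ ≠ 0)
    (hS : Module.IsTorsion (IwasawaAlgebra p) (S ⧸ Submodule.span (IwasawaAlgebra p) {κ}))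
    (ψ : X →ₗ[IwasawaAlgebra p] (IwasawaAlgebra p × Xt))
    (hψ : Finite ((IwasawaAlgebra p × Xt) ⧸ LinearMap.range ψ))
    (hXt : Module.IsTorsion (IwasawaAlgebra p) Xt)
    {c : ℤ_[p]} (hc : c ≠ 0)
    (hMC : Ideal.span {(PowerSeries.C c : IwasawaAlgebra p)} *
        Module.charIdeal (IwasawaAlgebra p) Xt ≤
      Module.charIdeal (IwasawaAlgebra p) (S ⧸ Submodule.span (IwasawaAlgebra p) {κ}) ^ 2)
    (hX : coinvariantsRank p X ≤ 1)
    (sp : coinvariants p S →+ H) (hsp : ∀ x, sp x = 0 → ∃ n : ℕ, p ^ n • x = 0) (m : ℕ) :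
    p ^ m • sp (Submodule.Quotient.mk κ) ≠ 0 :=
  pow_smul_specialization_ne_zero_of_lengthAt_eq_zero p hκ
    (lengthAt_primeT_eq_zero_of_C_mul_charIdeal_le_sq p hXt hS
      (finite_coinvariants_of_coinvariantsRank_le_one_of_prod p ψ hψ hX) hc hMC) sp hsp m

/-- The same for the Howard form, squared rational relation.
[cite: YanZhu2024MainConjNonCM, Thm. 4.15 (proof, §4.6)]
[cite: Wan2021HeegnerPointKolyvaginSystem, Thm. 3.17 (proof, p. 10)] -/
theorem pow_smul_specialization_ne_zero_of_C_mul_charIdeal_sq_le {S : Type u} {X : Type v}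
    {M : Type w} {H : Type*}
    [AddCommGroup S] [Module (IwasawaAlgebra p) S] [Module.Finite (IwasawaAlgebra p) S]
    [NoZeroSMulDivisors (IwasawaAlgebra p) S]
    [AddCommGroup X] [Module (IwasawaAlgebra p) X] [Module.Finite (IwasawaAlgebra p) X]
    [AddCommGroup M] [Module (IwasawaAlgebra p) M] [Module.Finite (IwasawaAlgebra p) M]
    [AddCommGroup H]
    {κ : S} (hκ : κ ≠ 0)
    (hS : Module.IsTorsion (IwasawaAlgebra p) (S ⧸ Submodule.span (IwasawaAlgebra p) {κ}))
    (hM : Module.IsTorsion (IwasawaAlgebra p) M)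
    (φ : X →ₗ[IwasawaAlgebra p] (IwasawaAlgebra p × M × M))
    (hφ : Finite ((IwasawaAlgebra p × M × M) ⧸ LinearMap.range φ))
    {c : ℤ_[p]} (hc : c ≠ 0)
    (hMC : Ideal.span {(PowerSeries.C c : IwasawaAlgebra p)} *
        Module.charIdeal (IwasawaAlgebra p) M ^ 2 ≤
      Module.charIdeal (IwasawaAlgebra p) (S ⧸ Submodule.span (IwasawaAlgebra p) {κ}) ^ 2)
    (hX : coinvariantsRank p X ≤ 1)
    (sp : coinvariants p S →+ H) (hsp : ∀ x, sp x = 0 → ∃ n : ℕ, p ^ n • x = 0) (m : ℕ) :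
    p ^ m • sp (Submodule.Quotient.mk κ) ≠ 0 :=
  pow_smul_specialization_ne_zero_of_lengthAt_eq_zero p hκ
    (lengthAt_primeT_eq_zero_of_C_mul_charIdeal_sq_le p hM hS
      (finite_coinvariants_of_coinvariantsRank_le_one p φ hφ hX) hc hMC) sp hsp m

/-! ### Howard-shaped inputs: ranks and the torsion submodule instead of maps -/

/-- **A nonzero finitely generated torsion-free `Λ`-module has infinite `Γ`-coinvariants.**
If `Q/TQ` were finite, of order `n`, then `n Q ⊆ T Q`, and Cayley–Hamilton
(`LinearMap.exists_monic_and_natDegree_eq_and_coeff_mem_pow_and_aeval_eq_zero`, for the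
endomorphism `n` and the ideal `(T)`) produces `a = n^d + (terms in (T))` with `a Q = 0`; the
constant coefficient of `a` is `n^d ≠ 0`, so `a ≠ 0` and the torsion-free `Q` vanishes — absurd.
(Equivalently `ℓ_𝔭(Q_Γ) ≥ 1` at `𝔭 = (T)`: a torsion-free module has positive rank at every
height-one prime.) [folklore] -/
theorem not_finite_coinvariants_of_isTorsionFree {Q : Type u} [AddCommGroup Q]
    [Module (IwasawaAlgebra p) Q] [Module.Finite (IwasawaAlgebra p) Q]
    [Module.IsTorsionFree (IwasawaAlgebra p) Q] [Nontrivial Q] :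
    ¬ Finite (coinvariants p Q) := by
  intro hfin
  set n : ℕ := Nat.card (coinvariants p Q) with hn
  have hn0 : n ≠ 0 := (Nat.card_pos (α := coinvariants p Q)).ne'
  set φ : Module.End (IwasawaAlgebra p) Q :=
    algebraMap (IwasawaAlgebra p) (Module.End (IwasawaAlgebra p) Q) (n : IwasawaAlgebra p) with hφ
  -- `n Q ⊆ T Q`
  have hrange : LinearMap.range φ ≤
      Ideal.span {(PowerSeries.X : IwasawaAlgebra p)} • (⊤ : Submodule (IwasawaAlgebra p) Q) := by
    rintro _ ⟨q, rfl⟩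
    rw [hφ, Module.algebraMap_end_apply]
    have h0 : (Submodule.Quotient.mk ((n : IwasawaAlgebra p) • q) : coinvariants p Q) = 0 := by
      rw [Submodule.Quotient.mk_smul, Nat.cast_smul_eq_nsmul, hn, card_nsmul_eq_zero']
    exact (Submodule.Quotient.mk_eq_zero _).mp h0
  obtain ⟨P, hmonic, -, hcoeff, hP⟩ :=
    LinearMap.exists_monic_and_natDegree_eq_and_coeff_mem_pow_and_aeval_eq_zero
      (IwasawaAlgebra p) φ _ hrange
  -- `a := P(n)` kills `Q`
  have hkill : ∀ q : Q, (P.eval (n : IwasawaAlgebra p)) • q = 0 := by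
    intro q
    rw [hφ, Polynomial.aeval_algebraMap_apply_eq_algebraMap_eval] at hP
    have h := LinearMap.congr_fun hP q
    rwa [Module.algebraMap_end_apply, LinearMap.zero_apply] at h
  -- the constant coefficient of `a` is `n ^ deg P ≠ 0`
  have hconst : PowerSeries.constantCoeff (P.eval (n : IwasawaAlgebra p)) =
      (n : ℤ_[p]) ^ P.natDegree := by
    rw [Polynomial.eval_eq_sum_range, Finset.sum_range_succ, map_add, map_sum, hmonic.coeff_natDegree,
      one_mul, map_pow, map_natCast, Finset.sum_eq_zero, zero_add]
    intro k hk
    rw [Finset.mem_range] at hk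
    have hmem : P.coeff k ∈ Ideal.span {(PowerSeries.X : IwasawaAlgebra p)} :=
      Ideal.pow_le_self (by omega) (hcoeff k)
    rw [map_mul, (mem_span_X_iff p _).mp hmem, zero_mul]
  have ha0 : P.eval (n : IwasawaAlgebra p) ≠ 0 := by
    intro h0
    rw [h0, map_zero] at hconst
    exact pow_ne_zero _ (Nat.cast_ne_zero.mpr hn0 : (n : ℤ_[p]) ≠ 0) hconst.symm
  obtain ⟨q, hq⟩ := exists_ne (0 : Q)
  exact hq ((smul_eq_zero.mp (hkill q)).resolve_left ha0)

/-- `ℓ_𝔭(Q_Γ) ≥ 1` at `𝔭 = (T)` for a nonzero finitely generated torsion-free `Λ`-module `Q`.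
[folklore] -/
theorem one_le_lengthAt_coinvariants_of_isTorsionFree {Q : Type u} [AddCommGroup Q]
    [Module (IwasawaAlgebra p) Q] [Module.Finite (IwasawaAlgebra p) Q]
    [Module.IsTorsionFree (IwasawaAlgebra p) Q] [Nontrivial Q] :
    1 ≤ Module.lengthAt (IwasawaAlgebra p) (coinvariants p Q) (primeT p) := by
  rw [Order.one_le_iff_ne_zero]
  intro h0
  exact not_finite_coinvariants_of_isTorsionFree p (Q := Q)
    ((finite_iff_lengthAt_eq_zero_of_X_smul_eq_zero p (coinvariants p Q)
      (fun q ↦ X_smul_coinvariants p Q q)).mpr h0)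

/-- **`S/Λκ` is torsion when `S` is torsion-free of rank one and `κ ≠ 0`** (rank–nullity over the
domain `Λ`: `rank (S/Λκ) + rank Λκ = rank S = 1` and `rank Λκ ≥ 1`). This converts Howard's
"`H¹_{F_Λ}(K, 𝐓)` is torsion-free of rank one" (Thm. B, as vendored: `Module.finrank Λ S = 1`,
`NoZeroSMulDivisors Λ S`) into the hypothesis `hS` of the skeleton lemmas. [folklore] -/
theorem isTorsion_quotient_span_singleton_of_finrank_eq_one {S : Type u} [AddCommGroup S]
    [Module (IwasawaAlgebra p) S] [Module.Finite (IwasawaAlgebra p) S]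
    [NoZeroSMulDivisors (IwasawaAlgebra p) S]
    (hS1 : Module.finrank (IwasawaAlgebra p) S = 1) {κ : S} (hκ : κ ≠ 0) :
    Module.IsTorsion (IwasawaAlgebra p) (S ⧸ Submodule.span (IwasawaAlgebra p) {κ}) := by
  have hS : Module.rank (IwasawaAlgebra p) S = 1 := by
    rw [← Module.finrank_eq_rank, hS1, Nat.cast_one]
  have hk : (1 : Cardinal) ≤ Module.rank (IwasawaAlgebra p) (Submodule.span (IwasawaAlgebra p) {κ}) :=
    Module.one_le_rank_of_smul_eq_zero_imp
      (⟨κ, Submodule.mem_span_singleton_self κ⟩ : Submodule.span (IwasawaAlgebra p) {κ})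
      fun a ha ↦ by
        have h : a • κ = 0 := by
          have := congrArg Subtype.val ha
          simpa using this
        exact (smul_eq_zero.mp h).resolve_right hκ
  have hsum := rank_quotient_add_rank_of_isDomain (Submodule.span (IwasawaAlgebra p) {κ})
  have hq0 : Module.rank (IwasawaAlgebra p) (S ⧸ Submodule.span (IwasawaAlgebra p) {κ}) = 0 := by
    by_contra hne
    have h1 : (1 : Cardinal) ≤
        Module.rank (IwasawaAlgebra p) (S ⧸ Submodule.span (IwasawaAlgebra p) {κ}) :=
      Cardinal.one_le_iff_ne_zero.mpr hne
    have h2 : (1 : Cardinal) + 1 ≤ Module.rank (IwasawaAlgebra p) S := hsum ▸ add_le_add h1 hk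
    rw [hS] at h2
    norm_num at h2
  exact rank_eq_zero_iff_isTorsion.mp hq0

/-- **Step 1, Howard's shape ("`X` has `Λ`-rank one", Thm. B (b)).** For a finitely generated
`Λ`-module `X` of rank one with `rank_{ℤ_p} X/TX ≤ 1`, the torsion submodule `X_tors` has finite
`Γ`-coinvariants: with `Q = X/X_tors` (torsion-free, nonzero as `rank X = 1 ≠ 0`), the sequence
`(X_tors)_Γ → X_Γ → Q_Γ → 0` is exact and its first map is injective (`t = Tx` forces `T x̄ = 0` in
the torsion-free `Q`, so `x ∈ X_tors`), whence `ℓ_𝔭((X_tors)_Γ) + ℓ_𝔭(Q_Γ) = ℓ_𝔭(X_Γ) ≤ 1` with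
`ℓ_𝔭(Q_Γ) ≥ 1` (`one_le_lengthAt_coinvariants_of_isTorsionFree`).
[cite: YanZhu2024MainConjNonCM, Thm. 4.12 (2)] [cite: Wan2021HeegnerPointKolyvaginSystem, proof of Thm. 3.17 (p. 10)] -/
theorem finite_coinvariants_torsion_of_finrank_eq_one {X : Type u} [AddCommGroup X]
    [Module (IwasawaAlgebra p) X] [Module.Finite (IwasawaAlgebra p) X]
    (hX1 : Module.finrank (IwasawaAlgebra p) X = 1) (hX : coinvariantsRank p X ≤ 1) :
    Finite (coinvariants p (Submodule.torsion (IwasawaAlgebra p) X)) := by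
  set Xt := Submodule.torsion (IwasawaAlgebra p) X with hXt
  -- `Q = X/X_tors` is nonzero since `rank X = 1`
  haveI : Nontrivial (X ⧸ Xt) := by
    by_contra htriv
    rw [not_nontrivial_iff_subsingleton, Submodule.Quotient.subsingleton_iff] at htriv
    have htor : Module.IsTorsion (IwasawaAlgebra p) X := fun x ↦ by
      have hx : x ∈ Xt := htriv ▸ Submodule.mem_top
      exact (Submodule.mem_torsion_iff x).mp hx
    have h0 := Module.finrank_eq_zero_iff_isTorsion.mpr htor
    omega
  -- the exact sequence of coinvariants, with injective first map
  have hinj : Function.Injective (coinvariantsMap Xt.subtype) := by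
    rw [injective_iff_map_eq_zero]
    intro t ht
    induction t using Submodule.Quotient.induction_on with
    | H t =>
      rw [coinvariantsMap_mk, Submodule.Quotient.mk_eq_zero, mem_TSubmodule_iff] at ht
      obtain ⟨x, hx⟩ := ht
      rw [Submodule.Quotient.mk_eq_zero, mem_TSubmodule_iff]
      have hxQ : (PowerSeries.X : IwasawaAlgebra p) • (Xt.mkQ x) = 0 := by
        rw [← map_smul, hx, Submodule.mkQ_apply, Submodule.Quotient.mk_eq_zero]
        exact t.2
      have hx0 : Xt.mkQ x = 0 := (smul_eq_zero.mp hxQ).resolve_left PowerSeries.X_ne_zero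
      rw [Submodule.mkQ_apply, Submodule.Quotient.mk_eq_zero] at hx0
      refine ⟨⟨x, hx0⟩, Subtype.ext ?_⟩
      simpa using hx
  have hexact := exact_coinvariantsMap Xt.subtype Xt.mkQ (Submodule.mkQ_surjective _)
    (LinearMap.exact_subtype_mkQ Xt)
  have hlen := Module.lengthAt_eq_add_of_exact _ _ hinj
    (coinvariantsMap_surjective Xt.mkQ (Submodule.mkQ_surjective _)) hexact (primeT p)
  rw [lengthAt_coinvariants_eq_coinvariantsRank p X] at hlen
  -- `ℓ((X_tors)_Γ) + 1 ≤ ℓ((X_tors)_Γ) + ℓ(Q_Γ) = rank X/TX ≤ 1`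
  set l := Module.lengthAt (IwasawaAlgebra p) (coinvariants p Xt) (primeT p) with hl
  have hne : l ≠ ⊤ :=
    Module.lengthAt_ne_top_of_isTorsionBy (s := (PowerSeries.X : IwasawaAlgebra p))
      PowerSeries.X_ne_zero (fun q ↦ X_smul_coinvariants p Xt q) (primeT p) (height_primeT p).le
  have hle : l + 1 ≤ 1 := by
    calc l + 1 ≤ l + Module.lengthAt (IwasawaAlgebra p) (coinvariants p (X ⧸ Xt)) (primeT p) :=
          add_le_add le_rfl (one_le_lengthAt_coinvariants_of_isTorsionFree p)
      _ = (coinvariantsRank p X : ℕ∞) := hlen.symm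
      _ ≤ 1 := by exact_mod_cast hX
  have h0 : l = 0 := by
    lift l to ℕ using hne with n hn
    have h' : n + 1 ≤ 1 := by exact_mod_cast hle
    have : n = 0 := by omega
    simp [this]
  exact (finite_iff_lengthAt_eq_zero_of_X_smul_eq_zero p (coinvariants p Xt)
    (fun q ↦ X_smul_coinvariants p Xt q)).mpr h0

/-- **The `p`-converse lemma from the rational Heegner point main conjecture, in the shape of
Howard's Thm. B as vendored (`Howard2004_thmB`).** Over `Λ = ℤ_[p]⟦T⟧` let `S` be finitely
generated, torsion-free, of rank one (`Module.finrank Λ S = 1`: "`H¹_{F_Λ}(K, 𝐓)` is torsion-free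
of rank one"), `κ ∈ S` nonzero (the generator of the free rank-one Heegner module `𝐇`,
`Howard2004_heegnerModule_free`; Cornut–Vatsal); `X` finitely generated of rank one
(`Module.finrank Λ X = 1`: "`X ∼ Λ ⊕ M ⊕ M`") with torsion submodule `X_tors`
(`Submodule.torsion`, `char(X_tors) = ch(M)²`); assume the RATIONAL main conjecture in the
direction opposite to Howard's (c), `c · char(X_tors) ⊆ char(S/Λκ)²` for a nonzero constant
`c ∈ ℤ_p` (Yan–Zhu Thm. 4.12 (2); Burungale–Castella–Skinner Thm. 1.2.2 (a)), and
`rank_{ℤ_p} X/TX ≤ 1` (anticyclotomic control + `corank_{ℤ_p} Sel_{p^∞}(E/K) = 1`). Then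
`p^m κ ∉ TS` for every `m`. [cite: YanZhu2024MainConjNonCM, Thm. 4.15 (proof, §4.6) with Thm. 4.12 (2)]
[cite: Wan2021HeegnerPointKolyvaginSystem, Thm. 3.17 (proof, p. 10)] -/
theorem pow_smul_notMem_TSubmodule_of_finrank_eq_one {S : Type u} {X : Type v}
    [AddCommGroup S] [Module (IwasawaAlgebra p) S] [Module.Finite (IwasawaAlgebra p) S]
    [NoZeroSMulDivisors (IwasawaAlgebra p) S]
    [AddCommGroup X] [Module (IwasawaAlgebra p) X] [Module.Finite (IwasawaAlgebra p) X]
    (hS1 : Module.finrank (IwasawaAlgebra p) S = 1) {κ : S} (hκ : κ ≠ 0)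
    (hX1 : Module.finrank (IwasawaAlgebra p) X = 1)
    {c : ℤ_[p]} (hc : c ≠ 0)
    (hMC : Ideal.span {(PowerSeries.C c : IwasawaAlgebra p)} *
        Module.charIdeal (IwasawaAlgebra p) (Submodule.torsion (IwasawaAlgebra p) X) ≤
      Module.charIdeal (IwasawaAlgebra p) (S ⧸ Submodule.span (IwasawaAlgebra p) {κ}) ^ 2)
    (hX : coinvariantsRank p X ≤ 1) (m : ℕ) :
    ((p : IwasawaAlgebra p) ^ m) • κ ∉ TSubmodule p S :=
  pow_smul_notMem_TSubmodule_of_lengthAt_eq_zero p hκ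
    (lengthAt_primeT_eq_zero_of_C_mul_charIdeal_le_sq p
      (Submodule.torsion_isTorsion (R := IwasawaAlgebra p) (M := X))
      (isTorsion_quotient_span_singleton_of_finrank_eq_one p hS1 hκ)
      (finite_coinvariants_torsion_of_finrank_eq_one p hX1 hX) hc hMC) m

/-- The index form: under the same hypotheses **`ℓ_𝔭(S/Λκ) = 0`** at `𝔭 = (T)` — in the
arithmetic application, Howard's Heegner-module index `ord_J char(S/𝐇)` vanishes
(`heegnerModuleIndex = 0`). [cite: YanZhu2024MainConjNonCM, Thm. 4.15 (proof, §4.6) with Thm. 4.12 (2)]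
[cite: Wan2021HeegnerPointKolyvaginSystem, Thm. 3.17 (proof, p. 10)] -/
theorem lengthAt_quotient_span_singleton_eq_zero_of_finrank_eq_one {S : Type u} {X : Type v}
    [AddCommGroup S] [Module (IwasawaAlgebra p) S] [Module.Finite (IwasawaAlgebra p) S]
    [NoZeroSMulDivisors (IwasawaAlgebra p) S]
    [AddCommGroup X] [Module (IwasawaAlgebra p) X] [Module.Finite (IwasawaAlgebra p) X]
    (hS1 : Module.finrank (IwasawaAlgebra p) S = 1) {κ : S} (hκ : κ ≠ 0)
    (hX1 : Module.finrank (IwasawaAlgebra p) X = 1)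
    {c : ℤ_[p]} (hc : c ≠ 0)
    (hMC : Ideal.span {(PowerSeries.C c : IwasawaAlgebra p)} *
        Module.charIdeal (IwasawaAlgebra p) (Submodule.torsion (IwasawaAlgebra p) X) ≤
      Module.charIdeal (IwasawaAlgebra p) (S ⧸ Submodule.span (IwasawaAlgebra p) {κ}) ^ 2)
    (hX : coinvariantsRank p X ≤ 1) :
    Module.lengthAt (IwasawaAlgebra p) (S ⧸ Submodule.span (IwasawaAlgebra p) {κ}) (primeT p) = 0 :=
  lengthAt_primeT_eq_zero_of_C_mul_charIdeal_le_sq p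
    (Submodule.torsion_isTorsion (R := IwasawaAlgebra p) (M := X))
    (isTorsion_quotient_span_singleton_of_finrank_eq_one p hS1 hκ)
    (finite_coinvariants_torsion_of_finrank_eq_one p hX1 hX) hc hMC

/-- **Specialisation, Howard's shape.** If moreover `sp : S/IS → H` is additive with
`p`-power-torsion kernel, then `p^m • sp (κ mod IS) ≠ 0` for every `m` ("`y_K` is non-torsion").
[cite: YanZhu2024MainConjNonCM, Thm. 4.15 (proof, §4.6)]
[cite: Wan2021HeegnerPointKolyvaginSystem, Thm. 3.17 (proof, p. 10)] -/
theorem pow_smul_specialization_ne_zero_of_finrank_eq_one {S : Type u} {X : Type v} {H : Type*}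
    [AddCommGroup S] [Module (IwasawaAlgebra p) S] [Module.Finite (IwasawaAlgebra p) S]
    [NoZeroSMulDivisors (IwasawaAlgebra p) S]
    [AddCommGroup X] [Module (IwasawaAlgebra p) X] [Module.Finite (IwasawaAlgebra p) X]
    [AddCommGroup H]
    (hS1 : Module.finrank (IwasawaAlgebra p) S = 1) {κ : S} (hκ : κ ≠ 0)
    (hX1 : Module.finrank (IwasawaAlgebra p) X = 1)
    {c : ℤ_[p]} (hc : c ≠ 0)
    (hMC : Ideal.span {(PowerSeries.C c : IwasawaAlgebra p)} *
        Module.charIdeal (IwasawaAlgebra p) (Submodule.torsion (IwasawaAlgebra p) X) ≤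
      Module.charIdeal (IwasawaAlgebra p) (S ⧸ Submodule.span (IwasawaAlgebra p) {κ}) ^ 2)
    (hX : coinvariantsRank p X ≤ 1)
    (sp : coinvariants p S →+ H) (hsp : ∀ x, sp x = 0 → ∃ n : ℕ, p ^ n • x = 0) (m : ℕ) :
    p ^ m • sp (Submodule.Quotient.mk κ) ≠ 0 :=
  pow_smul_specialization_ne_zero_of_lengthAt_eq_zero p hκ
    (lengthAt_quotient_span_singleton_eq_zero_of_finrank_eq_one p hS1 hκ hX1 hc hMC hX) sp hsp m

end Literature.NumberTheory.EllipticCurves.IwasawaAlgebra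

end
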